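import Summits.BirchSwinnertonDyer.Rank1Residual.X12.O11.RamifiedRelativeValuationLineZp
import HarnessLib

/-!
# O11 (CM, analytic rank one, the RAMIFIED prime): the ∃-FREE VALUATION LAW behind the research stub
# `S_arch` of the line `rubin-formula-zp` (skeleton v3), and the anatomy of `S_arch`'s classical packaging
# (cell `bsd-cm`, planner D123 (b) / D128 (c2) / D129 (a); line owner `bsd-cm-k7r-c4` g8; NOTHING asserted)

HONEST FRAMING. The registered research stub of the K7r value crux `EllipticUnitValueSevenOfGZK` is
`S_arch = RamifiedCMArchimedeanValuationAtZp W p D₀` (`RamifiedRelativeValuationLineZp.lean`, k7r-c4 g7): inside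
the frame / Mordell–Weil / `#Ш_an` telescope of the line and for every Hecke character `φ` pinned to `W`, THERE
ARE a globally minimal model `W₀` of the base member `49a1^{(D₀)}`, a character `φ₀` pinned to `W₀`, an exponent
`m` and a rational `r ≠ 0` with both continuations at `k = p^m`, `(L_W(p^m)/L_{W₀}(p^m))² = r`,
`ord_p r < 1 + 2m` and `ord_p r = B(W) := 2(n + n') + ord_p #Ш_an(W) + ord_p #Ш_an(W')`. As its docstring
records, that existential packages THREE CLASSICAL THEOREMS (a pinned `φ₀` on a minimal model of the base exists —
Deuring; the odd powers `φ^{2k+1}`, `φ₀^{2k+1}` have entire `L`-functions from their abscissa `re s = k + 3/2` —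
Hecke; the squared ratio of the two central values is RATIONAL — Waldspurger/Shimura) together with ONE research
statement, and it only asks for SOME exponent `m`. The cell's numerical programme (seat `bsd-cm-ram` g9/g10:
relrubin engine, 17/17 certified member instances, 0 against; planner D128 (c2): the pre-registered ENGINE-C
census with hypotheses H-STAB «the valuation is `m`-stable once `< 1 + 2m`» and H-BSD «the stable value is
`B(D)`», KILL = one certified member against) tests a SHARPER, ∃-free statement. This file types it and separates
the classical inputs, fact-free, nothing asserted:

* `S_law` = `RamifiedCMArchimedeanLawAtZp W p D₀` — **THE ∃-FREE VALUATION LAW** (`@[conjecture]`, RESEARCH):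
  in the same telescope, for EVERY `φ` pinned to `W`, EVERY globally minimal model `W₀` of `49a1^{(D₀)}`, EVERY
  `φ₀` pinned to `W₀`, EVERY exponent `m` with `B(W) < 1 + 2m` and every rational `r` with the two continuations
  and `(L_W(p^m)/L_{W₀}(p^m))² = r`: `r ≠ 0 ∧ ord_p r = B(W)`. The clause `r ≠ 0` (both central values of weight
  `2·p^m + 2` are non-zero above the threshold) is part of the law: it is what the mechanism predicts (the unit
  base `ℒ(W₀) ∈ Λ^×` for `W₀`; `ord_π ℒ_W(ξ_{p^m}) = ord_π ℒ_W(𝟙) = B(W) < ∞` for `W`, memo RELATIVE-RUBIN §1) and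
  what the engine certifies («GENUINE», `ρ²` a non-zero rational square). KILL = one member, one `m` above
  threshold, with `ord_p r ≠ B` or a vanishing central value. Instances certified so far (`p = 7`, `D₀ = −11`):
  the 13 unit prime members (`B = 0`; `m = 0, 1`, and `m = 2` at `−23`) and the four non-unit members `−79`,
  `−107` (`B = 2·2 + 0`), `−1187`, `−1471` (`B = 2·1 + 2`) at `m = 2` (kit j264297/j264301/j264634/j264771/
  j264773). CLASS-WIDE = a `Λ`-adic Kohnen–Waldspurger law at a prime RAMIFIED in `K` — no print precedent
  (Koblitz 1986, Sofer 1996, Rodriguez Villegas 1991/93 are at split `p`); the structural frame of record is the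
  Gross-period family on the definite quaternion algebra `B_{7,∞}` (cell note NOTE-TORIC (C1)–(C5), D128).
* `S_hecke` = `RamifiedCMOddPowerContinuationAtZp W p` — typed input, A THEOREM IN PRINT not yet derivable in
  the tree: for every `φ` pinned to an elliptic curve over `ℚ` by `L(φ, s) = L(V, s)` on `re s > 3/2` (then `φ`
  is a Größencharakter of weight one) and every `m`, `heckeLFunction (φ^(2·p^m+1))` has an entire continuation
  from `re s > p^m + 3/2` (Hecke 1920; Tate 1950 Thm. 4.4.1 is stated for QUASI-characters `c = c₀‖·‖^s`: entire
  unless a norm twist). The tree's named fact `heckeLFunction_hasEntireContinuation_of_not_isNormTwist` covers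
  UNITARY characters from `re s > 1` only; the discharge needs `|φ| = ‖·‖^{−1/2}` on all ideles (compactness of
  `C_K¹`) and «`φ^{2k+1}` is not a norm twist» — recorded as the gap, not hidden.
* `S_rat` = `RamifiedCMCentralRatioRationalAtZp W p D₀` — typed input, IN PRINT in substance: for pinned `φ`,
  `φ₀` as above and every `m`, `(L_W(p^m)/L_{W₀}(p^m))²` is a RATIONAL number (both are central values of the
  weight-`(2p^m + 2)` CM newform `θ(ψ^{2p^m+1})` twisted by the quadratic characters `χ_D`, `χ_{D₀}`; Waldspurger
  1981 Thm. 1: `L(f ⊗ χ_D, k+1)|D|^{k+½} ∝ c(|D|)²` with one proportionality constant per square class, `f`, `g`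
  with rational coefficients here — so the ratio is even `(|D₀|/|D|)^{2k+1}` times a rational SQUARE, as the
  engine observes: `ρ` rational in every certified row). Discharge = Waldspurger/Shimura algebraicity in the
  tree's `heckeLFunction` currency — not available; recorded as the gap.
* `ramifiedCMArchimedeanValuationAtZp_of_law` — **PROVED: base model + `S_hecke` + `S_rat` + `S_law` ⟹
  `S_arch`**, for every `W`, `p`, `D₀`, with the base clause («some globally minimal model of `49a1^{(D₀)}`
  carries a pinned Hecke character of the frame field», Deuring) as an explicit hypothesis; at `p = 7`,
  `D₀ = −11` on 𝒞₇ that hypothesis is DISCHARGED Theorems-side from the tree's named fact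
  `Deuring_exists_heckeCharacter_of_maximalCM` (Silverman ATAEC II Thm. 10.5 (b)) on the kernel-certified
  minimal model `5929e1` (`RouteU.exists_variableChange_c5929e1`) — file
  `Theorems/RamifiedSevenEllipticUnitsArchimedeanLawSeven.lean`. Choice of the exponent: `m := B.toNat`
  (`B < 1 + 2m` always).

So, granted the three classical inputs, the research content of `S_arch` is EXACTLY `S_law` restricted to one
exponent per member; `S_law` is the statement the census tests and the statement a refuter can kill with one
certified row. Its VALUE form (ram g10 PREREG-RRF P7♯: `σ_∞(D;D₀) = (|D|/|D₀|)·Rub(W_D)/Rub(W_{D₀})`, Rubin's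
1992 `p`-adic formula transplanted to the ramified prime, read relatively) is NOT typed here (pending the
pre-registered test on the confirmation set S2; it needs the formal-group logarithm / real period / height
vocabulary and is the planner's call, STATUS 03:11:11Z). Nothing here is in print as a statement at a ramified
prime; BSD is not proved by any of this; no label, tier or count moves.

References: [BKNO] A. Burungale, S. Kobayashi, K. Nakamura, K. Ota, arXiv:2608.06879v1 (2026) Thm. 4.12, §1.4
[BurungaleKobayashiNakamuraOta2026]; J. Tate, thesis (1950) Thm. 4.4.1 [TateThesis1967]; E. Hecke, Math. Z. 6
(1920) [HeckeMathZ1920]; J.-L. Waldspurger, J. Math. Pures Appl. 60 (1981) Thm. 1 [Waldspurger1981Fourier];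
W. Kohnen, D. Zagier (1984) [KohnenZagier1984]; J. Silverman, ATAEC (1994) II Thm. 10.5 [SilvermanATAEC1994];
B. Gross, D. Zagier (1986) I.(7.3) [GrossZagier1986]; cell memos RELATIVE-RUBIN-ram-g9.md §§1–4,
PREREG-RRF-ram-g10.md, NOTE-k7r-c2-g6-TORIC.md, Lines/rubin-formula-zp.md v3.1; STATUS D123/D128/D129.
-/

noncomputable section

open scoped Classical

open WeierstrassCurve NumberField IsDedekindDomain Field PowerSeries
  Literature.NumberTheory.EllipticCurves
  Literature.NumberTheory.EllipticCurves.Rank1Residual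
  Literature.NumberTheory.EllipticCurves.Rank1Residual.Typed
  Literature.NumberTheory.EllipticCurves.Castella2018
  Literature.NumberTheory.EllipticCurves.BurungaleKobayashiNakamuraOta2026
  Literature.NumberTheory.GaloisRepresentations
  Literature.NumberTheory.DiophantineGeometry
  Summit.BirchSwinnertonDyer.Rank1Residual.Additive

namespace Summit.BirchSwinnertonDyer.Rank1Residual.X12.O11

section ArchimedeanLawLineZp

variable (W : WeierstrassCurve ℚ) [W.IsElliptic] [W.IsGloballyMinimal] (p : ℕ) [Fact p.Prime] (D₀ : ℤ)

/-- **S_law — THE ∃-FREE ARCHIMEDEAN VALUATION LAW (typed input; OPEN — RESEARCH; nothing asserted):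
`∀ m, B(W) < 1 + 2m ⟹ r_{p^m}(W; W₀) ≠ 0 ∧ ord_p r_{p^m}(W; W₀) = B(W)`.** At every analytic-rank-one O11
frame `(K, 𝔭, W', C)` of `(W, p)` with its Mordell–Weil data (`P`, `P'` generators modulo torsion, no `p`-torsion
over `ℚ_p`, exact `p`-power levels `n`, `n'` in `W(ℚ_p)`, `W'(ℚ_p)`), `#Ш_an(W) = q`, `#Ш_an(W') = q'`, for EVERY
Hecke character `φ` of `K` pinned to `W` (`L(φ, s) = L(W, s)` on `re s > 3/2`), EVERY globally minimal model `W₀`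
of the base member `49a1^{(D₀)}` (`∃ C₀, C₀ • W₀ = cm7.quadraticTwist D₀`), EVERY `φ₀` pinned to `W₀`, EVERY
exponent `m : ℕ` with `B(W) := 2(n + n') + padicValRat p q + padicValRat p q' < 1 + 2m`, and every rational `r`
such that both odd powers `φ^{2p^m+1}`, `φ₀^{2p^m+1}` have entire `L`-functions from `re s > p^m + 3/2` and
`(heckePowerCentralValue φ (p^m) / heckePowerCentralValue φ₀ (p^m))² = r`:  `r ≠ 0` AND `padicValRat p r = B(W)`.
This is the hypothesis pair H-STAB ∧ H-BSD of the cell's pre-registered ENGINE-C census (planner D128 (c2)) as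
one closed statement, and the ∃-free strengthening of the registered stub `RamifiedCMArchimedeanValuationAtZp`
(which it implies granted the classical inputs, `ramifiedCMArchimedeanValuationAtZp_of_law`). MECHANISM that
predicts it (memo RELATIVE-RUBIN-ram-g9 §1, not a proof): `ord_π ℒ_W(ξ_{p^m}) = ord_p r` ([BKNO] Thm. 4.12 at
the de Rham characters + the `D`-independence of the `p`-adic period + the unit base), `ord_π(ℒ_W(ξ_{p^m}) −
ℒ_W(𝟙)) ≥ 1 + 2m` (ultrametric), `ord_π ℒ_W(𝟙) = λ₀(W) = B(W)` (Thm. 7.2 at `𝟙` + the value formula `S_open`);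
hence above the threshold the valuation is STABLE and equals `B(W)`, and both central values are non-zero.
CERTIFIED INSTANCES (`p = 7`, `D₀ = −11`): 13 unit prime members (`B = 0`), `−79`, `−107` (`B = 4 = 2·2 + 0`),
`−1187`, `−1471` (`B = 4 = 2·1 + ord₇ 49`) — kit j264297, j264301, j264634, j264771, j264773; 0 against.
The threshold is part of the statement, not decoration: at `D = −79`, `m = 0` (`B = 4 ≥ 1 + 0`) the central
value `L(ψ_{−79}³, 2)` VANISHES (to 96 digits, root number `+1`; ram g9 memo RELATIVE-RUBIN §4 (P4)), so no
`m`-unconditional form of the law is expected to hold.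
KILL: one member and one `m` with `B < 1 + 2m` where `ord_p r ≠ B` or a central value vanishes. CLASS-WIDE: a
`Λ`-adic Kohnen–Waldspurger law at a prime ramified in `K` — NOT in print (the split-prime precedents do not
transfer); structural frame: Gross periods on `B_{p,∞}` (cell note NOTE-TORIC). RESEARCH; nothing asserted.
[cite: BurungaleKobayashiNakamuraOta2026, Thm. 4.12 and §1.4 (arXiv:2608.06879 pp. 8, 32) (claim; preprint; shape only)]
[cite: GrossZagier1986, Thm. I.(7.3) (rationality of #Ш_an; shape only)] -/
@[conjecture] def RamifiedCMArchimedeanLawAtZp : Prop :=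
  ∀ (K : Type) [Field K] [NumberField K] (𝔭 : HeightOneSpectrum (𝓞 K))
    (W' : WeierstrassCurve ℚ) [W'.IsElliptic] [W'.IsGloballyMinimal] (C : VariableChange ℚ),
    IsFrame W p K 𝔭 W' C → W.analyticRank = 1 →
      ∀ (P : W.toAffine.Point) (n : ℕ) (P' : W'.toAffine.Point) (n' : ℕ),
        ¬ IsOfFinAddOrder P →
        (∀ R : W.toAffine.Point, ∃ (k : ℤ) (T : W.toAffine.Point), IsOfFinAddOrder T ∧ R = k • P + T) →
        (∀ Q : (W.baseChange ℚ_[p]).toAffine.Point, p • Q = 0 → Q = 0) →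
        (∃ Q : (W.baseChange ℚ_[p]).toAffine.Point, p ^ n • Q = W.toPadicPoint p P) →
        (∀ Q : (W.baseChange ℚ_[p]).toAffine.Point, p ^ (n + 1) • Q ≠ W.toPadicPoint p P) →
        ¬ IsOfFinAddOrder P' →
        (∀ R : W'.toAffine.Point, ∃ (k : ℤ) (T : W'.toAffine.Point),
          IsOfFinAddOrder T ∧ R = k • P' + T) →
        (∀ Q : (W'.baseChange ℚ_[p]).toAffine.Point, p • Q = 0 → Q = 0) →
        (∃ Q : (W'.baseChange ℚ_[p]).toAffine.Point, p ^ n' • Q = W'.toPadicPoint p P') →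
        (∀ Q : (W'.baseChange ℚ_[p]).toAffine.Point, p ^ (n' + 1) • Q ≠ W'.toPadicPoint p P') →
        ∀ (q q' : ℚ), shaAn W = (q : ℂ) → shaAn W' = (q' : ℂ) →
        ∀ (φ : HeckeCharacter K), (∀ s : ℂ, 3 / 2 < s.re → heckeLFunction φ s = W.LSeries s) →
          ∀ (W₀ : WeierstrassCurve ℚ) [W₀.IsElliptic] [W₀.IsGloballyMinimal],
            (∃ C₀ : VariableChange ℚ, C₀ • W₀ = cm7.quadraticTwist (D₀ : ℚ)) →
            ∀ (φ₀ : HeckeCharacter K),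
              (∀ s : ℂ, 3 / 2 < s.re → heckeLFunction φ₀ s = W₀.LSeries s) →
              ∀ (m : ℕ) (r : ℚ),
                LFunction.HasEntireContinuationFrom (((p ^ m : ℕ) : ℝ) + 3 / 2)
                    (heckeLFunction (φ ^ (2 * p ^ m + 1))) →
                  LFunction.HasEntireContinuationFrom (((p ^ m : ℕ) : ℝ) + 3 / 2)
                    (heckeLFunction (φ₀ ^ (2 * p ^ m + 1))) →
                (heckePowerCentralValue φ (p ^ m) / heckePowerCentralValue φ₀ (p ^ m)) ^ 2 = (r : ℂ) →
                2 * ((n : ℤ) + n') + padicValRat p q + padicValRat p q' < 1 + 2 * (m : ℤ) →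
                r ≠ 0 ∧ padicValRat p r = 2 * ((n : ℤ) + n') + padicValRat p q + padicValRat p q'

/-- **S_hecke — ENTIRE CONTINUATION OF THE ODD POWERS (typed input; a THEOREM IN PRINT whose tree discharge
is not yet available; nothing asserted).** For every number field `K`, every elliptic curve `V/ℚ`, every Hecke
character `φ` of `K` pinned to `V` (`heckeLFunction φ s = V.LSeries s` on `re s > 3/2` — then `φ` is the
Größencharakter of a CM curve, of weight one: `|φ(ϖ_v)| = N v^{1/2}` at the unramified places) and every
`m : ℕ`: the primitive Euler product `heckeLFunction (φ ^ (2·p^m + 1))` (absolutely convergent on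
`re s > p^m + 3/2`, the abscissa for weight `2p^m + 1`) has an entire continuation from that half-plane. IN
PRINT: Hecke (1920); Tate's thesis Thm. 4.4.1 is stated for quasi-characters `c = c₀‖·‖^s` of the idele class
group — the zeta function is entire unless `c` is a norm twist — so `L(φ^{2k+1}, s) = L(χ_u, s − k − ½)` with
`χ_u := φ^{2k+1}‖·‖^{k+½}` unitary and not a norm twist. The tree's named fact
`heckeLFunction_hasEntireContinuation_of_not_isNormTwist` is the UNITARY case from `re s > 1`; the discharge of
this input additionally needs `|φ| = ‖·‖^{−1/2}` on ALL ideles (compactness of `C_K¹`) and «`φ^{2k+1}` is not a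
norm twist» (its values at two inert primes are negative reals of different size) — typed glue not in the tree.
Recorded as an input so that `S_arch`'s continuation clauses are not mistaken for research content.
[cite: TateThesis1967, Thm. 4.4.1 (quasi-characters; shape only)] [cite: HeckeMathZ1920, §1 (shape only)] -/
@[conjecture] def RamifiedCMOddPowerContinuationAtZp : Prop :=
  ∀ (K : Type) [Field K] [NumberField K] (V : WeierstrassCurve ℚ) [V.IsElliptic] (φ : HeckeCharacter K),
    (∀ s : ℂ, 3 / 2 < s.re → heckeLFunction φ s = V.LSeries s) →
      ∀ m : ℕ, LFunction.HasEntireContinuationFrom (((p ^ m : ℕ) : ℝ) + 3 / 2)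
        (heckeLFunction (φ ^ (2 * p ^ m + 1)))

/-- **S_rat — RATIONALITY OF THE SQUARED CENTRAL-VALUE RATIO (typed input; IN PRINT in substance, no tree
discharge; nothing asserted).** For every frame field `K` of `(W, p)`, every `φ` pinned to `W`, every globally
minimal model `W₀` of `49a1^{(D₀)}`, every `φ₀` pinned to `W₀` and every `m`, the complex number
`(heckePowerCentralValue φ (p^m) / heckePowerCentralValue φ₀ (p^m))²` is (the image of) a RATIONAL number. The
two values are the central values `L(f ⊗ χ_D, k+1)`, `L(f ⊗ χ_{D₀}, k+1)` (`k = p^m`) of ONE CM newform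
`f = θ(ψ^{2k+1})` of weight `2k + 2` with rational coefficients twisted by two quadratic characters of the same
square class at `p` and `∞`; Waldspurger's theorem gives `L(f ⊗ χ_D, k+1)·|D|^{k+½} = c_f · a_g(|D|)²` with
ONE constant `c_f` per square class and `g` (weight `k + 3/2`) with rational coefficients, so the squared ratio
is `(|D₀|/|D|)^{2k+1}` times a rational square (the engine finds `ρ_k` rational in every certified row). If a
continuation fails the carrier is junk and the clause is not claimed to be meaningful — it is used only
together with `S_hecke`. The discharge (Waldspurger/Shimura algebraicity in the `heckeLFunction` currency) is
not in the tree; recorded as an input, not as research content.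
[cite: Waldspurger1981Fourier, Thm. 1 (shape only)] [cite: KohnenZagier1984, Thm. 1 (shape only)]
[cite: BurungaleKobayashiNakamuraOta2026, §1.4 (arXiv:2608.06879 p. 8) (shape only)] -/
@[conjecture] def RamifiedCMCentralRatioRationalAtZp : Prop :=
  ∀ (K : Type) [Field K] [NumberField K] (𝔭 : HeightOneSpectrum (𝓞 K))
    (W' : WeierstrassCurve ℚ) [W'.IsElliptic] [W'.IsGloballyMinimal] (C : VariableChange ℚ),
    IsFrame W p K 𝔭 W' C →
      ∀ (φ : HeckeCharacter K), (∀ s : ℂ, 3 / 2 < s.re → heckeLFunction φ s = W.LSeries s) →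
        ∀ (W₀ : WeierstrassCurve ℚ) [W₀.IsElliptic] [W₀.IsGloballyMinimal],
          (∃ C₀ : VariableChange ℚ, C₀ • W₀ = cm7.quadraticTwist (D₀ : ℚ)) →
          ∀ (φ₀ : HeckeCharacter K),
            (∀ s : ℂ, 3 / 2 < s.re → heckeLFunction φ₀ s = W₀.LSeries s) →
            ∀ m : ℕ, ∃ r : ℚ,
              (heckePowerCentralValue φ (p ^ m) / heckePowerCentralValue φ₀ (p ^ m)) ^ 2 = (r : ℂ)

variable {W p D₀}

/-- The exponent choice: for every integer `B`, `B < 1 + 2·(B.toNat)`. [folklore] -/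
theorem lt_one_add_two_mul_toNat (B : ℤ) : B < 1 + 2 * ((B.toNat : ℕ) : ℤ) := by
  have h₁ : B ≤ ((B.toNat : ℕ) : ℤ) := Int.self_le_toNat B
  have h₂ : (0 : ℤ) ≤ ((B.toNat : ℕ) : ℤ) := Int.natCast_nonneg _
  omega

omit [W.IsGloballyMinimal] in
/-- **BASE MODEL + `S_hecke` + `S_rat` + `S_law` ⟹ `S_arch` (PROVED).** Granted (i) the base clause — at every
frame field `K` of `(W, p)` SOME globally minimal model `W₀` of `49a1^{(D₀)}` carries a Hecke character `φ₀` of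
`K` pinned to it (Deuring's theorem, Silverman ATAEC II Thm. 10.5 (b); at `p = 7`, `D₀ = −11` on 𝒞₇ this is
discharged Theorems-side from the tree fact `Deuring_exists_heckeCharacter_of_maximalCM` on the minimal model
`5929e1`), (ii) `S_hecke` (continuations of the odd powers for `φ` and `φ₀`), (iii) `S_rat` (the squared ratio
is rational) and (iv) the law `S_law`: the registered stub shape `RamifiedCMArchimedeanValuationAtZp W p D₀`
follows — take that `W₀`, `φ₀`, the exponent `m := B(W).toNat` (so `B(W) < 1 + 2m`), the rational `r` of (iii);
(iv) gives `r ≠ 0` and `ord_p r = B(W)`, whence also `ord_p r < 1 + 2m`. So the research content of `S_arch`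
is `S_law` at one exponent per member; everything else in it is classical.
[cite: SilvermanATAEC1994, Ch. II Thm. 10.5 (b) (the base clause; shape only)]
[cite: BurungaleKobayashiNakamuraOta2026, §1.4 (arXiv:2608.06879 p. 8) (shape only)] -/
theorem ramifiedCMArchimedeanValuationAtZp_of_law
    (hbase : ∀ (K : Type) [Field K] [NumberField K] (𝔭 : HeightOneSpectrum (𝓞 K))
      (W' : WeierstrassCurve ℚ) [W'.IsElliptic] [W'.IsGloballyMinimal] (C : VariableChange ℚ),
      IsFrame W p K 𝔭 W' C →
        ∃ (W₀ : WeierstrassCurve ℚ) (_ : W₀.IsElliptic) (_ : W₀.IsGloballyMinimal)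
          (_ : ∃ C₀ : VariableChange ℚ, C₀ • W₀ = cm7.quadraticTwist (D₀ : ℚ)) (φ₀ : HeckeCharacter K),
          ∀ s : ℂ, 3 / 2 < s.re → heckeLFunction φ₀ s = W₀.LSeries s)
    (hhecke : RamifiedCMOddPowerContinuationAtZp p) (hrat : RamifiedCMCentralRatioRationalAtZp W p D₀)
    (hlaw : RamifiedCMArchimedeanLawAtZp W p D₀) : RamifiedCMArchimedeanValuationAtZp W p D₀ := by
  intro K _ _ 𝔭 W' _ _ C hF hr P n P' n' hP hgen htors hdiv hndiv hP' hgen' htors' hdiv' hndiv'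
    q q' hq hq' φ hφ
  obtain ⟨W₀, _, _, hW₀, φ₀, hφ₀⟩ := hbase K 𝔭 W' C hF
  set B : ℤ := 2 * ((n : ℤ) + n') + padicValRat p q + padicValRat p q' with hB
  obtain ⟨r, hρ⟩ := hrat K 𝔭 W' C hF φ hφ W₀ hW₀ φ₀ hφ₀ B.toNat
  have hcont := hhecke K W φ hφ B.toNat
  have hcont₀ := hhecke K W₀ φ₀ hφ₀ B.toNat
  have hlt : B < 1 + 2 * ((B.toNat : ℕ) : ℤ) := lt_one_add_two_mul_toNat B
  obtain ⟨hr0, hval⟩ := hlaw K 𝔭 W' C hF hr P n P' n' hP hgen htors hdiv hndiv hP' hgen' htors' hdiv'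
    hndiv' q q' hq hq' φ hφ W₀ hW₀ φ₀ hφ₀ B.toNat r hcont hcont₀ hρ hlt
  exact ⟨W₀, ‹_›, ‹_›, hW₀, φ₀, hφ₀, B.toNat, r, hcont, hcont₀, hρ, hr0, by rw [hval]; exact hlt, hval⟩

omit [W.IsGloballyMinimal] in
/-- **Conversely, nothing is lost at the registered exponent: `S_arch`'s witness is an instance of `S_law`'s
conclusion shape** — if the law holds, then at ANY exponent above the threshold (not only the witness's) the
valuation is `B(W)`; in particular two exponents `m₁, m₂` above the threshold give the same valuation
(STABILITY, hypothesis H-STAB of the census). [cite: BurungaleKobayashiNakamuraOta2026, §1.4 (arXiv:2608.06879 p. 8) (shape only)] -/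
theorem RamifiedCMArchimedeanLawAtZp.stable (hlaw : RamifiedCMArchimedeanLawAtZp W p D₀)
    {K : Type} [Field K] [NumberField K] {𝔭 : HeightOneSpectrum (𝓞 K)}
    {W' : WeierstrassCurve ℚ} [W'.IsElliptic] [W'.IsGloballyMinimal] {C : VariableChange ℚ}
    (hF : IsFrame W p K 𝔭 W' C) (hr : W.analyticRank = 1)
    {P : W.toAffine.Point} {n : ℕ} {P' : W'.toAffine.Point} {n' : ℕ}
    (hP : ¬ IsOfFinAddOrder P)
    (hgen : ∀ R : W.toAffine.Point, ∃ (k : ℤ) (T : W.toAffine.Point), IsOfFinAddOrder T ∧ R = k • P + T)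
    (htors : ∀ Q : (W.baseChange ℚ_[p]).toAffine.Point, p • Q = 0 → Q = 0)
    (hdiv : ∃ Q : (W.baseChange ℚ_[p]).toAffine.Point, p ^ n • Q = W.toPadicPoint p P)
    (hndiv : ∀ Q : (W.baseChange ℚ_[p]).toAffine.Point, p ^ (n + 1) • Q ≠ W.toPadicPoint p P)
    (hP' : ¬ IsOfFinAddOrder P')
    (hgen' : ∀ R : W'.toAffine.Point, ∃ (k : ℤ) (T : W'.toAffine.Point),
      IsOfFinAddOrder T ∧ R = k • P' + T)
    (htors' : ∀ Q : (W'.baseChange ℚ_[p]).toAffine.Point, p • Q = 0 → Q = 0)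
    (hdiv' : ∃ Q : (W'.baseChange ℚ_[p]).toAffine.Point, p ^ n' • Q = W'.toPadicPoint p P')
    (hndiv' : ∀ Q : (W'.baseChange ℚ_[p]).toAffine.Point, p ^ (n' + 1) • Q ≠ W'.toPadicPoint p P')
    {q q' : ℚ} (hq : shaAn W = (q : ℂ)) (hq' : shaAn W' = (q' : ℂ))
    {φ : HeckeCharacter K} (hφ : ∀ s : ℂ, 3 / 2 < s.re → heckeLFunction φ s = W.LSeries s)
    {W₀ : WeierstrassCurve ℚ} [W₀.IsElliptic] [W₀.IsGloballyMinimal]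
    (hW₀ : ∃ C₀ : VariableChange ℚ, C₀ • W₀ = cm7.quadraticTwist (D₀ : ℚ))
    {φ₀ : HeckeCharacter K} (hφ₀ : ∀ s : ℂ, 3 / 2 < s.re → heckeLFunction φ₀ s = W₀.LSeries s)
    {m₁ m₂ : ℕ} {r₁ r₂ : ℚ}
    (hc₁ : LFunction.HasEntireContinuationFrom (((p ^ m₁ : ℕ) : ℝ) + 3 / 2)
      (heckeLFunction (φ ^ (2 * p ^ m₁ + 1))))
    (hc₁' : LFunction.HasEntireContinuationFrom (((p ^ m₁ : ℕ) : ℝ) + 3 / 2)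
      (heckeLFunction (φ₀ ^ (2 * p ^ m₁ + 1))))
    (hρ₁ : (heckePowerCentralValue φ (p ^ m₁) / heckePowerCentralValue φ₀ (p ^ m₁)) ^ 2 = (r₁ : ℂ))
    (hc₂ : LFunction.HasEntireContinuationFrom (((p ^ m₂ : ℕ) : ℝ) + 3 / 2)
      (heckeLFunction (φ ^ (2 * p ^ m₂ + 1))))
    (hc₂' : LFunction.HasEntireContinuationFrom (((p ^ m₂ : ℕ) : ℝ) + 3 / 2)
      (heckeLFunction (φ₀ ^ (2 * p ^ m₂ + 1))))
    (hρ₂ : (heckePowerCentralValue φ (p ^ m₂) / heckePowerCentralValue φ₀ (p ^ m₂)) ^ 2 = (r₂ : ℂ))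
    (h₁ : 2 * ((n : ℤ) + n') + padicValRat p q + padicValRat p q' < 1 + 2 * (m₁ : ℤ))
    (h₂ : 2 * ((n : ℤ) + n') + padicValRat p q + padicValRat p q' < 1 + 2 * (m₂ : ℤ)) :
    r₁ ≠ 0 ∧ r₂ ≠ 0 ∧ padicValRat p r₁ = padicValRat p r₂ := by
  obtain ⟨h10, hv₁⟩ := hlaw K 𝔭 W' C hF hr P n P' n' hP hgen htors hdiv hndiv hP' hgen' htors' hdiv'
    hndiv' q q' hq hq' φ hφ W₀ hW₀ φ₀ hφ₀ m₁ r₁ hc₁ hc₁' hρ₁ h₁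
  obtain ⟨h20, hv₂⟩ := hlaw K 𝔭 W' C hF hr P n P' n' hP hgen htors hdiv hndiv hP' hgen' htors' hdiv'
    hndiv' q q' hq hq' φ hφ W₀ hW₀ φ₀ hφ₀ m₂ r₂ hc₂ hc₂' hρ₂ h₂
  exact ⟨h10, h20, by rw [hv₁, hv₂]⟩

omit [W.IsGloballyMinimal] in
/-- **The whole line with the law in place of `S_arch`'s research content** (PROVED composition): `S_dict′ →
S_sat-Zp → S_B4′ → S_relval → [base + S_hecke + S_rat + S_law] → (R-PR)|IMC-Zp`, by
`ramifiedCMArchimedeanValuationAtZp_of_law` followed by the v3 composition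
`ramifiedCMBottomClassIndexLawAtZp_of_dictZp_of_satZp_of_splitZp_of_relval_of_arch`. [cite: Miller2011LMS, Def. 1.1] -/
theorem ramifiedCMBottomClassIndexLawAtZp_of_dictZp_of_satZp_of_splitZp_of_relval_of_law
    (hdict : RamifiedCMLocalMordellWeilDictAtZp W p) (hsat : RamifiedCMBottomSaturationAtZp W p)
    (hsplit : RamifiedCMBottomLocalIndexSplitAtZp W p) (hrel : RamifiedCMRelativeValuationAtZp W p D₀)
    (hbase : ∀ (K : Type) [Field K] [NumberField K] (𝔭 : HeightOneSpectrum (𝓞 K))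
      (W' : WeierstrassCurve ℚ) [W'.IsElliptic] [W'.IsGloballyMinimal] (C : VariableChange ℚ),
      IsFrame W p K 𝔭 W' C →
        ∃ (W₀ : WeierstrassCurve ℚ) (_ : W₀.IsElliptic) (_ : W₀.IsGloballyMinimal)
          (_ : ∃ C₀ : VariableChange ℚ, C₀ • W₀ = cm7.quadraticTwist (D₀ : ℚ)) (φ₀ : HeckeCharacter K),
          ∀ s : ℂ, 3 / 2 < s.re → heckeLFunction φ₀ s = W₀.LSeries s)
    (hhecke : RamifiedCMOddPowerContinuationAtZp p) (hrat : RamifiedCMCentralRatioRationalAtZp W p D₀)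
    (hlaw : RamifiedCMArchimedeanLawAtZp W p D₀) : RamifiedCMBottomClassIndexLawAtZp W p :=
  ramifiedCMBottomClassIndexLawAtZp_of_dictZp_of_satZp_of_splitZp_of_relval_of_arch hdict hsat hsplit hrel
    (ramifiedCMArchimedeanValuationAtZp_of_law hbase hhecke hrat hlaw)

end ArchimedeanLawLineZp

end Summit.BirchSwinnertonDyer.Rank1Residual.X12.O11

end
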